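import Summits.QuantumFields.YangMills.Theorems.UnitScaleTiltProp7SymCentreOfAbelianSupplier
import Summits.QuantumFields.YangMills.Theorems.UnitScaleTiltProp7SymCentreAbelianWrap
import Summits.QuantumFields.YangMills.Theorems.UnitScaleTiltProp7SymCentreAbelianFibre
import Summits.QuantumFields.YangMills.Theorems.UnitScaleTiltProp7SymCentreAbelianRegPr
import HarnessLib

/-!
# Route `UnitScaleTilt`, crux K1 child «MinimiserStabilityRegPr» (stmt-QuantumFields-19200), stub `stub_existenceMinimalOrbit` (EX), line «SYM-CENTRE»
# (★★OWNER RULING g28-№7 cure (ii-a)) — **THE (R4) ASSEMBLY: the displayed row `hSymCentre`'s ∃-body for EVERY small-plaquette coarse field with a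
# regular fibre point, from ONE displayed flux-sector brick `hFlux` (★w5-20520 g8 «FLUX-COMBINE», in flight); and, unconditionally, the FLUX-FREE members**

Cell `ym3-torus`, width seat `ym3-torus-px6` (gen 3; (R4) assembly pen by ★px20 g2's 23:15:23Z word).  THEOREMS ONLY (0 `def`, 0 `sorry`).
`--supports stmt-QuantumFields-19200 --as helper`, count-neutral.  YM₃ on T³ is a ladder rung (R3), not the Clay problem; nothing here claims the stub, the
crux, d = 4 or the mass gap.

THE CHAIN, BY NAME.  ✓`exists_symCentre_of_diagonalLiftSupplier` (✓p675211: irreducible ∕ re-gauge ∕ central-in-disguise ∕ undo-gauge ∕ `hLift` bridge) reduces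
`hSymCentre` to a supplier for σ₃-DIAGONAL case-A coarse fields `V′`.  For such `V′`: angles `V′ = gexpAt θ` (✓`exists_eq_gexpAt_of_forall_commute_sigma3`,
w4-20520 g9); near-integer plaquette angles `|curlAt Θ − 2π m| ≤ (π∕2)ε₁` for `Θ := θ` read on `T^{(K−n)}` of run `K` (✓`exists_int_near_curl_of_plaqSmall`, WRAP);
THEN either (flux-free, §1) `m = 0`: exact smooth lift + `RegPr (2·10⁶·(π∕2)ε₁)` (✓`exists_lift_regPr_gexpAt_sigma3`, px19 CS-ARITH over ✓p674080) and fibre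
exactness under the curl guard (✓`diag_mem_fibre_diag_T3`, w4); or (general, §2) the flux-sector brick `hFlux` (DISPLAYED — ZCLASS ∘ FLUX-LIFT ∘ smooth lift
∘ loop-sum rows ∘ mod-ℤ `RegPr`, all ✓∕⧗ by w5-20520 g8) returning `a` with `linAvgIter (K−n) a = Θ − 2πs`, loop-sum rows and `RegPr`; the re-lettered coarse
angles `θ − 2πs` give the SAME `V′` (✓`gexpAt_I_smul_sigma3_add_two_pi_mul_int`) and fibre exactness follows from ✓`diag_mem_fibre_diag_of_loopSum_T3`.
* §1 ★★`diagonalLift_of_fluxFree` — the flux-free supplier (unconditional).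
* §2 ★★★`diagonalLift_of_fluxCombine` — the general supplier from `hFlux`; ★★★`exists_symCentre_of_fluxCombine` — `hSymCentre`'s ∃-body for EVERY `V` with
  `PlaqSmall ε₁ V`, `U₀ ∈ fibre V`, `RegPr a U₀`, modulo `hFlux` and the numeric windows.
HONEST SCOPE.  Composition; `hFlux` is the open brick (its inhabitation = ★w5 g8's FLUX-COMBINE); no stub ∕ crux statement is advanced.

References: T. Bałaban, CMP 102 (1985) 277–309 [Balaban1985Variational] ((2)–(7) p.278, (13)–(14) p.280); CMP 98 (1985) 17–51 [Balaban1985Averaging] ((9), (11)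
p.19, (19)–(24) p.21); CMP 109 (1987) 249–301 [Balaban1987RG1] ((0.4), (0.11) p.253); CMP 99 (1985) 389–434 [Balaban1985BackgroundPropagators] ((3.21) p.394).
-/

set_option autoImplicit false

noncomputable section

open scoped BigOperators Matrix.Norms.L2Operator Matrix

namespace Summit.QuantumFields.YangMills.Theorems.Prop7NestedMeanParallelLiftDiagGauge

open Literature.MathematicalPhysics.QuantumFieldTheory.Balaban1983to89
open T4Continuum
open B10Eq27TorusAxialLog (unitsField toUField)
open B15DeterminingSets (embIter)
open B9AdOrthogonal (σ₃)
open BlockAveraging (Idx)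
open Summit.QuantumFields.YangMills.Theorems.Prop8Chart (emlIterU)
open Literature.MathematicalPhysics.QuantumFieldTheory.Balaban1983to89.T3ContinuumYM3Torus
open T3UnitLawDensityEML (ℰp)
open T3ConstrainedMinimiser (fibre)
open T3PrintedRegularMinimiser (RegPr)
open T3PrintedMinimiserExistence (regPr_mono)
open T3PrintedRegularOrbits (sites_eq)
open T3SectALandauChart (bgUnits CloseAvg)
open T3LevelShift (bondShift bondShift_src bondShift_tgt siteShift)
open Summit.QuantumFields.Balaban3D.Carriers (suGroupModel)
open Summit.QuantumFields.YangMills.Theorems.BalabanUVNodesN08AlphaAbelianLift (gexp)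
open Summit.QuantumFields.YangMills.Theorems.AbelianEML (gexpAt linAvgIter loopSum curlAt)
open Summit.QuantumFields.YangMills.Theorems.Prop7SymCentreAbelianDict (I_smul_sigma3_mem_lie exists_lift_regPr_gexpAt_sigma3)
open Summit.QuantumFields.YangMills.Theorems.Prop7SymCentreAbelianFibre (exists_eq_gexpAt_of_forall_commute_sigma3 commute_coe_gexpAt_sigma3
  diag_mem_fibre_diag_T3 diag_mem_fibre_diag_of_loopSum_T3 gexpAt_I_smul_sigma3_add_two_pi_mul_int)

section T3

variable (F : T3Family) {n K : ℕ}

/-! ## §0 Coarse angles read on the top of run `K` -/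

/-- The curl commutes with the level identification `bondShift`: reading a top-level one-form `Θ` of run `K` on the comparison lattice of run `n`
(`c ↦ Θ (bondShift c)`) and taking the curl there is the curl of `Θ` at the shifted site. [cite: Balaban1987RG1, (0.11) p.253] -/
theorem curlAt_comp_bondShift (h : n ≤ K) (Θ : PBond (F.P K) (K - n) → ℝ) (y : Site (F.P n) 0) (μ ν : Fin (F.P n).d) :
    curlAt (fun c : PBond (F.P n) 0 => Θ (bondShift (sites_eq F n K h) c)) y μ ν = curlAt Θ (siteShift (sites_eq F n K h) y) μ ν := by
  have hsh : ∀ (z : Site (F.P n) 0) (κ : Fin (F.P n).d), siteShift (sites_eq F n K h) (z.shift κ) = (siteShift (sites_eq F n K h) z).shift κ :=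
    fun z κ => T3LevelShift.siteShift_shift (sites_eq F n K h) z κ
  simp only [curlAt]
  show Θ ⟨siteShift (sites_eq F n K h) y, μ⟩ + Θ ⟨siteShift (sites_eq F n K h) (y.shift μ), ν⟩ -
      Θ ⟨siteShift (sites_eq F n K h) (y.shift ν), μ⟩ - Θ ⟨siteShift (sites_eq F n K h) y, ν⟩ = _
  rw [hsh y μ, hsh y ν]
  rfl

/-! ## §1 The flux-free members -/

/-- ★★ **THE FLUX-FREE DIAGONAL LIFT.**  For a σ₃-diagonal coarse `V′ = gexpAt θ` whose plaquette ANGLES themselves are small on the top of run `K`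
(`|curlAt Θ| ≤ φ`, `Θ = θ` read through `bondShift`; the flux-free members of the small-plaquette class), the smooth exact lift `a` of ✓p674080 gives a σ₃-diagonal
`U₁ := gexpAt a ∈ fibre V′` with `RegPr (2·10⁶·φ) U₁` (px19 CS-ARITH), fibre exactness under the curl guard `30·L²·54³·φ ≤ 1` (w4 R4-FIBRE).
[cite: Balaban1985Variational, (6)-(7) p.278; Balaban1987RG1, (0.4) p.253; Balaban1985Averaging, (9) p.19] -/
theorem diagonalLift_of_fluxFree (h : n ≤ K) (θ : PBond (F.P n) 0 → ℝ) {φ : ℝ} (hφ : 0 < φ)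
    (hwin : 30 * (F.L : ℝ) ^ 2 * ((54 : ℝ) ^ 3 * φ) ≤ 1)
    (hcurl : ∀ (x : Site (F.P K) (K - n)) (μ ν : Fin (F.P K).d), μ ≠ ν →
      |curlAt (fun e : PBond (F.P K) (K - n) => θ ((bondShift (sites_eq F n K h)).symm e)) x μ ν| ≤ φ) :
    ∃ U₁ : GaugeField (F.P K) 0 (Matrix.specialUnitaryGroup (Fin 2) ℂ),
      U₁ ∈ fibre F ℰp n K h (gexpAt (suGroupModel 2) I_smul_sigma3_mem_lie θ) ∧ RegPr F n K (2000000 * φ) U₁ ∧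
      ∀ b : PBond (F.P K) 0, Commute ((U₁ b : Matrix.specialUnitaryGroup (Fin 2) ℂ) : Matrix (Fin 2) (Fin 2) ℂ) σ₃ := by
  obtain ⟨a, hav, h1, -, hreg⟩ := exists_lift_regPr_gexpAt_sigma3 F n K _ hφ hcurl
  have hL : (0 : ℝ) < F.L := T3LowerAlongMinimisersSplit.L_cast_pos F
  refine ⟨gexpAt (suGroupModel 2) I_smul_sigma3_mem_lie a, ?_, hreg, commute_coe_gexpAt_sigma3 a⟩
  refine diag_mem_fibre_diag_T3 F h a θ (B := (54 : ℝ) ^ 3 * φ / ((F.L : ℝ) ^ (K - n)) ^ 2) (by positivity) h1 ?_ fun c => ?_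
  · -- the window: `(L²)^(K−n) · (54³φ∕(L^(K−n))²) = 54³φ`
    have hpow : ((F.L : ℝ) ^ 2) ^ (K - n) = ((F.L : ℝ) ^ (K - n)) ^ 2 := by rw [← pow_mul, ← pow_mul, mul_comm]
    rw [hpow, mul_div_cancel₀ _ (by positivity)]
    exact hwin
  · rw [hav]
    show θ ((bondShift (sites_eq F n K h)).symm (bondShift (sites_eq F n K h) c)) = θ c
    rw [Equiv.symm_apply_apply]

/-! ## §2 The general members from the flux-sector brick -/

/-- ★★★ **THE DIAGONAL LIFT FROM «FLUX-COMBINE».**  DISPLAYED `hFlux` (★w5-20520 g8's brick, in flight): on the top of run `K`, for angles `Θ` with near-integer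
plaquette angles `|curlAt Θ − 2π m| ≤ φ₀` (`m` an integer function vanishing on `μ = μ`), `φ₀ ≤ cF`, there are an integer re-lettering `s` and a fine one-form `a`
with EXACT average `linAvgIter (K−n) a = Θ − 2πs`, the loop-sum guards of every level, and `RegPr (CF·φ₀) (gexpAt a)`.  CONCLUSION: the supplier `hSup` of
✓`exists_symCentre_of_diagonalLiftSupplier` at `δ := ε₁`, `a′ := CF·(π∕2)·ε₁` — for every σ₃-diagonal `V′` with `PlaqSmall ε₁ V′` (`(π∕2)ε₁ ≤ cF`), a σ₃-diagonal
`U₁ ∈ fibre V′` with `RegPr (CF·(π∕2)·ε₁) U₁` (WRAP ✓p677333 ∘ `hFlux` ∘ periodicity ∘ ✓`diag_mem_fibre_diag_of_loopSum_T3`).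
[cite: Balaban1985Variational, (6)-(7) p.278; Balaban1987RG1, (0.4) p.253; Balaban1985Averaging, (9), (22)-(24) pp.19-21] -/
theorem diagonalLift_of_fluxCombine (h : n ≤ K) {cF CF ε₁ : ℝ} (hε₁ : 0 < ε₁) (hε : Real.pi / 2 * ε₁ ≤ cF)
    (hFlux : ∀ (Θ : PBond (F.P K) (K - n) → ℝ) (m : Site (F.P K) (K - n) → Fin (F.P K).d → Fin (F.P K).d → ℤ) (φ₀ : ℝ),
      0 < φ₀ → φ₀ ≤ cF → (∀ x μ, m x μ μ = 0) →
      (∀ (x : Site (F.P K) (K - n)) (μ ν : Fin (F.P K).d), μ ≠ ν → |curlAt Θ x μ ν - 2 * Real.pi * m x μ ν| ≤ φ₀) →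
      ∃ (s : PBond (F.P K) (K - n) → ℤ) (a : PBond (F.P K) 0 → ℝ),
        (linAvgIter (K - n) a = fun e => Θ e - 2 * Real.pi * s e) ∧
        (∀ s', s' < K - n → ∀ (c : PBond (F.P K) (s' + 1)) (i : Idx (F.P K)), 3 * |loopSum (linAvgIter s' a) c i| < 1) ∧
        RegPr F n K (CF * φ₀) (gexpAt (suGroupModel 2) I_smul_sigma3_mem_lie a))
    (V' : GaugeField (F.P n) 0 (Matrix.specialUnitaryGroup (Fin 2) ℂ))
    (hdiag : ∀ e : PBond (F.P n) 0, Commute ((V' e : Matrix.specialUnitaryGroup (Fin 2) ℂ) : Matrix (Fin 2) (Fin 2) ℂ) σ₃) (hV' : PlaqSmall ε₁ V') :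
    ∃ U₁ : GaugeField (F.P K) 0 (Matrix.specialUnitaryGroup (Fin 2) ℂ), U₁ ∈ fibre F ℰp n K h V' ∧ RegPr F n K (CF * (Real.pi / 2 * ε₁)) U₁ ∧
      ∀ b : PBond (F.P K) 0, Commute ((U₁ b : Matrix.specialUnitaryGroup (Fin 2) ℂ) : Matrix (Fin 2) (Fin 2) ℂ) σ₃ := by
  -- angles of the diagonal field, read on the top of run `K`
  obtain ⟨θ, rfl⟩ := exists_eq_gexpAt_of_forall_commute_sigma3 V' hdiag
  set Θ : PBond (F.P K) (K - n) → ℝ := fun e => θ ((bondShift (sites_eq F n K h)).symm e) with hΘ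
  -- the transported configuration has the same (small) plaquette variables
  -- `θ` is `Θ` read back through `bondShift`
  have hθΘ : θ = fun c : PBond (F.P n) 0 => Θ (bondShift (sites_eq F n K h) c) := by
    funext c; simp only [hΘ, Equiv.symm_apply_apply]
  have hΘsmall : PlaqSmall ε₁ (gexpAt (suGroupModel 2) I_smul_sigma3_mem_lie Θ : GaugeField (F.P K) (K - n) (Matrix.specialUnitaryGroup (Fin 2) ℂ)) := by
    intro p
    have hp := hV' ⟨(siteShift (sites_eq F n K h)).symm p.src, p.μ, p.ν, p.hμν⟩
    rw [Prop7SymCentreAbelianDict.plaqHol_gexpAt_curlAt] at hp ⊢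
    have hc := curlAt_comp_bondShift F h Θ ((siteShift (sites_eq F n K h)).symm p.src) p.μ p.ν
    rw [Equiv.apply_symm_apply, ← hθΘ] at hc
    have hc' : curlAt θ ((siteShift (sites_eq F n K h)).symm p.src) p.μ p.ν = curlAt Θ p.src p.μ p.ν := hc
    rw [hc'] at hp
    exact hp
  -- near-integer plaquette angles (WRAP)
  obtain ⟨m, hm0, hm⟩ := exists_int_near_curl_of_plaqSmall Θ hΘsmall
  -- the flux-sector brick
  obtain ⟨s, a, hav, hloop, hreg⟩ := hFlux Θ m (Real.pi / 2 * ε₁) (by positivity) hε hm0 hm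
  refine ⟨gexpAt (suGroupModel 2) I_smul_sigma3_mem_lie a, ?_, hreg, commute_coe_gexpAt_sigma3 a⟩
  -- the re-lettered coarse angles give the same coarse field
  have hV : gexpAt (suGroupModel 2) I_smul_sigma3_mem_lie θ =
      gexpAt (suGroupModel 2) I_smul_sigma3_mem_lie (fun c : PBond (F.P n) 0 => θ c + 2 * Real.pi * ((-s (bondShift (sites_eq F n K h) c) : ℤ) : ℝ)) :=
    (gexpAt_I_smul_sigma3_add_two_pi_mul_int θ fun c => -s (bondShift (sites_eq F n K h) c)).symm
  rw [hV]
  refine diag_mem_fibre_diag_of_loopSum_T3 F h a _ hloop fun c => ?_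
  rw [hav]
  show Θ (bondShift (sites_eq F n K h) c) - 2 * Real.pi * s (bondShift (sites_eq F n K h) c) = _
  rw [hΘ]
  simp only [Equiv.symm_apply_apply, Int.cast_neg]
  ring

/-- ★★★ **`hSymCentre`'s ∃-BODY FOR EVERY SMALL-PLAQUETTE COARSE FIELD, MODULO «FLUX-COMBINE».**  For every `V` with `PlaqSmall ε₁ V` (`ε₁ ≤ 2`, `(π∕2)ε₁ ≤ cF`) and
every `U₀ ∈ fibre V` with `RegPr a U₀` (`0 < a`, `10⁷L³a ≤ 1`, `a ≤ CF·(π∕2)·ε₁`, `10⁷L³·CF·(π∕2)·ε₁ ≤ 1`): `∃ U₁ ∈ fibre V` with `RegPr (CF·(π∕2)·ε₁) U₁`, `CloseAvg b V U₁`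
and the lifting residue `hLift U₁` — ✓`exists_symCentre_of_diagonalLiftSupplier` ∘ §2. [cite: Balaban1985Variational, (2)-(7) p.278, (13)-(14) p.280; Balaban1985BackgroundPropagators, (3.21) p.394] -/
theorem exists_symCentre_of_fluxCombine (h : n ≤ K) {cF CF ε₁ a b : ℝ} (hε₁ : 0 < ε₁) (hε2 : ε₁ ≤ 2) (hε : Real.pi / 2 * ε₁ ≤ cF)
    (ha : 0 < a) (haW : 10 ^ 7 * (F.L : ℝ) ^ 3 * a ≤ 1) (haa' : a ≤ CF * (Real.pi / 2 * ε₁)) (ha'W : 10 ^ 7 * (F.L : ℝ) ^ 3 * (CF * (Real.pi / 2 * ε₁)) ≤ 1)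
    (hb : 0 < b)
    (hFlux : ∀ (Θ : PBond (F.P K) (K - n) → ℝ) (m : Site (F.P K) (K - n) → Fin (F.P K).d → Fin (F.P K).d → ℤ) (φ₀ : ℝ),
      0 < φ₀ → φ₀ ≤ cF → (∀ x μ, m x μ μ = 0) →
      (∀ (x : Site (F.P K) (K - n)) (μ ν : Fin (F.P K).d), μ ≠ ν → |curlAt Θ x μ ν - 2 * Real.pi * m x μ ν| ≤ φ₀) →
      ∃ (s : PBond (F.P K) (K - n) → ℤ) (a : PBond (F.P K) 0 → ℝ),
        (linAvgIter (K - n) a = fun e => Θ e - 2 * Real.pi * s e) ∧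
        (∀ s', s' < K - n → ∀ (c : PBond (F.P K) (s' + 1)) (i : Idx (F.P K)), 3 * |loopSum (linAvgIter s' a) c i| < 1) ∧
        RegPr F n K (CF * φ₀) (gexpAt (suGroupModel 2) I_smul_sigma3_mem_lie a))
    {V : GaugeField (F.P n) 0 (Matrix.specialUnitaryGroup (Fin 2) ℂ)} {U₀ : GaugeField (F.P K) 0 (Matrix.specialUnitaryGroup (Fin 2) ℂ)}
    (hV : PlaqSmall ε₁ V) (hfib : U₀ ∈ fibre F ℰp n K h V) (hreg : RegPr F n K a U₀) :
    ∃ U₁ : GaugeField (F.P K) 0 (Matrix.specialUnitaryGroup (Fin 2) ℂ),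
      U₁ ∈ fibre F ℰp n K h V ∧ RegPr F n K (CF * (Real.pi / 2 * ε₁)) U₁ ∧ CloseAvg F n K h b V U₁ ∧
      ∀ cf : Site (F.P K) (K - n) → Matrix (Fin 2) (Fin 2) ℂ,
        (∀ e : PBond (F.P K) (K - n), cf e.src = ((emlIterU (K - n) (bgUnits F K U₁) e : (Matrix (Fin 2) (Fin 2) ℂ)ˣ) : Matrix (Fin 2) (Fin 2) ℂ) * cf e.tgt *
          (((emlIterU (K - n) (bgUnits F K U₁) e)⁻¹ : (Matrix (Fin 2) (Fin 2) ℂ)ˣ) : Matrix (Fin 2) (Fin 2) ℂ)) →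
        ∃ l₀ : Site (F.P K) 0 → Matrix (Fin 2) (Fin 2) ℂ,
          (∀ b' : PBond (F.P K) 0, l₀ b'.src = ((bgUnits F K U₁ b' : (Matrix (Fin 2) (Fin 2) ℂ)ˣ) : Matrix (Fin 2) (Fin 2) ℂ) * l₀ b'.tgt * (((bgUnits F K U₁ b')⁻¹ : (Matrix (Fin 2) (Fin 2) ℂ)ˣ) : Matrix (Fin 2) (Fin 2) ℂ)) ∧
          ∀ y : Site (F.P K) (K - n), l₀ (embIter (K - n) y) = cf y :=
  exists_symCentre_of_diagonalLiftSupplier F h hε2 ha haW haa' ha'W hb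
    (fun V' hdiag _ hV' => diagonalLift_of_fluxCombine F h hε₁ hε hFlux V' hdiag hV') hV hfib hreg

end T3

end Summit.QuantumFields.YangMills.Theorems.Prop7NestedMeanParallelLiftDiagGauge

end
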